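import Literature.MathematicalPhysics.QuantumFieldTheory.Balaban1983to89.B9QLettersAtPins
import Literature.MathematicalPhysics.QuantumFieldTheory.Balaban1983to89.B9Thm313WholeQstarFromG0

/-!
# `Balaban1983to89.B9LettersZQstarFieldsAtPins` — [B9] Theorems 3.12–3.13 (pp. 420–426): EVERY SUP ∕ HÖLDER-PROBE `Q*`- AND `Q`-COMPOSITE
# LETTER FIELD OF THE ROWS-20–21 Z-SCHEMAS (`LettersHZ.gQs2 ∕ dgQs`, `Letters313Z(c).gQs2 ∕ gQs1 ∕ q2 ∕ q1`, `Letters313DZ.dgQs`,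
# `Letters313DMZ.dgQsd ∕ pQd`, `Letters313HZ(c).pXQs`) AT THE N06 CERTIFICATE'S PINS — every member, every `Reg335` configuration

T. Bałaban, *Propagators for lattice gauge theories in a background field*, Commun. Math. Phys. **99** (1985) 389–434
[`Balaban1985BackgroundPropagators`, "B9"]; [4] = T. Bałaban, *Propagators and renormalization transformations for lattice gauge
theories. II*, Commun. Math. Phys. **96** (1984) 223–250 [`Balaban1984PropagatorsII`].

statement-level skeleton of published theorems with citation tags; proofs where landed; nothing here is a claim about the Yang–Mills
mass gap

THE PRINT.  (3.126) p. 420 *"HB = GQ\*(QGQ\*)⁻¹B"*, (3.129) p. 421, (3.133) p. 422, (3.153) p. 426 *"𝔊 = G₁ − G₁DRD\*G₁ − G₁Q\*(QG₁Q\*)⁻¹QG₁"*: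
the Sect.-D letters of Theorems 3.12–3.13 contain the composites of `G₀ = G(U)` (and of ∇_UG₀, ∇_{U,ν}G₀, Φ_β∘∇_{U,ν}G₀, Φ^X_β∘G₀) with the
adjoint `Q*` of the averaging operator (3.110) p. 417, and the operator `Q` itself.  In print each composite is Theorem 3.3 p. 399 for `G₀`
((3.42)₀,₁, (3.43)) followed by `Q*`, whose only property used is a KINEMATIC letter (block-local, bounded by the plateau weight).

THE POINT (cell `pub-ymgap`, node N06 [B9]; width seat w5, the (c2) «derive route» of the w5 lineage).  The stage-11 certificate of record
(dag-n06-d, editions ≥ 35) DISPLAYS the whole letter schemas `hlettersH12 : … → LettersHZ …`, `hletters13 : … → Letters313Z …` (re-cut: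
`Letters313Zc`), `hlettersD13 : … → Letters313DZ … ∧ Letters313DMZ …`, `hLH3 : … → Letters313HZ …` (re-cut: `Letters313HZc`), although their
`Q*`∕`Q`-composite fields are — field by field — dag-n06-l's engines `B9Thm313WholeQstarFromG0.gQs2_of_e0 ∕ dgQs_of_e1 ∕ gQs1_of_e0 ∕
pQ_of_h43 ∕ pXQs_of_pX0` applied to (i) the G₀ LAYER the certificate already DERIVES (`Thm33G0.e0`, `LeftStep.e1`, `Thm33G0Dir.e1d ∕ h43d`,
the ED.31 probe face `pX0`) and (ii) this base's KINEMATIC letters of node00-def-Y's coordinate models at the pins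
(`B9QstarLettersAtPins.hasMaj_Qstar_pins`, `B9QLettersAtPins.hasMaj_Q_pins`).  THIS FILE types the compositions AT THE PINS, member level,
FIELD BY FIELD (each conclusion is the schema field's statement VERBATIM over generic Sect.-D letters `𝔬` with the pins as equations, so it
serves the record schemas AND their re-cut twins alike, and any later edition may consume any subset):
* §1 zeroth order: ★★ `gQs2_pins` (`G₀Q* : Z_{n⁻¹} → 𝔠⁽²⁾` — `LettersHZ.gQs2` = `Letters313Z(c).gQs2`), ★★ `gQs1_pins` (`G₀Q* : Z_{len·n⁻¹} → 𝔠⁽¹⁾`,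
  one p.-398 transfer — `Letters313Z(c).gQs1`);
* §2 first order: ★★ `dgQs_pins` (`∇_UG₀Q* : Z_{n⁻¹} → 𝔠_Y⁽¹⁾` — `LettersHZ.dgQs` = `Letters313DZ.dgQs`), ★★ `dgQsd_pins` (`∇_{U,ν}G₀Q* : Z_{n⁻¹} → 𝔠⁽¹⁾`
  — `Letters313DMZ.dgQsd ν`);
* §3 Hölder probes: ★★ `pQd_pins` (`Φ^X_β∘∇_{U,ν}G₀Q* : Z_{n⁻¹} → 𝔠_P^{(β−1)}` — `Letters313DMZ.pQd ν β`; the SAME closed letter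
  `Bh β·e^{δ_Q(ℓ+4)}·c` as ED.37's `hLHH`), ★★ `pXQs_pins` (`Φ^X_β∘G₀Q* : Z_{len·n⁻¹} → 𝔠_P^{(β−1)}` — `Letters313HZ(c).pXQs β`, from the
  probe face `pX0`);
* §4 the operator Q: ★ `q_pins p` (`Q : 𝔠⁽ᵖ⁾ → Z⁽ᵖ⁾` sharp — `Letters313Z(c).q2 ∕ q1` at `p = 2, 1`).
KNIT (dag-n06-d, an edition after ED.38∕39, owner's call): e.g. `(hletters13 …).gQs2 ↦ gQs2_pins x (hβ1 x) hU hrow hc hB12₀ hδQ hδ₃ hδ₃0 hδ₃Q hB₃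
(hblk12 x) (hblkZ12 x) (hQsco12 x U) (hmodel12 x …).1.e0 _`, so that the displayed schema binders shrink to their `C ∕ C₁ ∕ G₀D ∕ rgd ∕ bH13`
(and, after the re-cut, `gXH ∕ wGp ∕ pWE`) fields; the member threshold of `q_pins` is dag-n06-w3's `B9Letters313AtOneQ.transfer_threshold`
(`p·log(ℓ+1)∕ε ≤ M`).  The block-L² twins are `B9LettersZQstarFieldsAtPinsL2`.

HONEST SCOPE.  By-name compositions of landed producer files (p608208, p610279, dag-n06-l's `B9Thm313WholeQstarFromG0`); the G₀-layer letters
(`he0 ∕ he1 ∕ he1d ∕ h43d ∕ hpX0`), the member facts `Facts347` and the row-sum letter are HYPOTHESES of each theorem; nothing of [B9]'s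
Theorems 3.3 ∕ 3.12 ∕ 3.13 is asserted; COUNT-NEUTRAL; N06 is NOT discharged; one finite lattice at a time; nothing continuum, nothing about
the mass gap ∕ Clay.  Cell `pub-ymgap` (HUMAN RULING D-0062 ∕ D-0154), Track A node N06 [B9], width seat `pub-ymgap-dag-n06-w5` (g3), 2026-08-28.
-/

noncomputable section

namespace Literature.MathematicalPhysics.QuantumFieldTheory.Balaban1983to89.B9LettersZQstarFieldsAtPins

open scoped Matrix.Norms.L2Operator
open Node00 B6GlobalChartV1 B6KLevelCensusIndexV1
open B6Geom246MultiLevelTorus (geomT)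
open B6Ineq2142KLevelV1 (β lvl)
open B6RandomWalk (HasMajorant)
open B6RandomWalkHom (HasMajorantHom)
open B7Prop2SpecialUnitary (specialUnitaryUnits)
open B9PinMembersKLevelV1 (MemberY geo9Y bg9Y)
open B9CoReadingCoordsTranspose (TrIdx trBasis)
open B9CoReadingCoords (XBK blkBK)
open B9CoReadingCoordsH (XHK blkHK)
open B9GeoNormsKLevelV1 (geo9K geo9K_dist_nonneg)
open B9GeoLemma21KLevelV1 (geo9Y_dist_triangle geo9Y_dist_comm geo9Y_len_pos geo9K_one_le_L)
open B9Thm34Ext (toB6)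
open B9SectDSup (weightNorm)
open B11SectG (HasMaj BlockNorm RowSum)
open B9Thm312Whole (Ops GeoOK cNorm)
open B9Thm312WholeClasses (cNormR)
open B9RWSums343Holder (HolderProbes)
open B9RWSums343to347Whole (Facts347)
open Node00.OpsYSectDCoords (QscoKH QcoKH)
open B9QstarLettersAtPins (hasMaj_Qstar_pins)
open B9QLettersAtPins (hasMaj_Q_pins)
open B9Thm313WholeQstarFromG0 (gQs2_of_e0 dgQs_of_e1 gQs1_of_e0 pQ_of_h43 pXQs_of_pX0)

variable {d ℓ : ℕ} {hd : 1 ≤ d + 1} {hL : Odd (ℓ + 1) ∧ 1 < ℓ + 1} {b₀ b₁ : ℝ} {Mstar : ℕ} {N : ℕ} [NeZero N]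
variable [∀ x : MemberY d ℓ hd hL b₀ b₁ Mstar, Fintype (geo9Y x).Site]

/-! ## §1 Zeroth order: `G₀Q*` into `𝔠⁽²⁾` and, after one transfer, into `𝔠⁽¹⁾` -/

/-- ★★ **`G₀Q*` OUT OF THE WEIGHTED AVERAGING CLASS `Z_{n⁻¹}` INTO `𝔠⁽²⁾` AT THE PINS** — the field `LettersHZ.gQs2` = `Letters313Z.gQs2` =
`Letters313Zc.gQs2` of the rows-20–21 schemas, every member, every `Reg335` `U`: from the (3.42)₀ letter of `G₀` (`he0`, the G₀ layer's
`Thm33G0.e0` — HYPOTHESIS), this base's `Q*`-letter `hasMaj_Qstar_pins` at rate `δ_Q` and dag-n06-l's `gQs2_of_e0`; any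
`B₃ ≥ B₀·e^{δ_Q(ℓ+4)}·c`, rates `0 ≤ δ₃ ≤ δ₀`, `δ₃ + σ ≤ δ_Q`, `0 ≤ δ_Q`.
[cite: Balaban1985BackgroundPropagators, (3.126) p.420 + (3.153) p.426 + (3.42) p.397 + (3.110) p.417 + (3.40) p.397; Balaban1984PropagatorsII, (2.52)–(2.56) pp.232–233 + Lemma 2.1 (2.61) p.234] -/
theorem gQs2_pins (x : MemberY d ℓ hd hL b₀ b₁ Mstar) {bI : FBondY x.toKIdx → IBondY x.toKIdx}
    (hβ1 : ∀ f : FBondY x.toKIdx, (geomT x.D).dist (β x.hN x.D x.hk (bI f)) (blkV1 x.hN x.D f) ≤ 1)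
    {Y W : Type} [Fintype Y] [Fintype W]
    {𝔬 : Ops (geo9Y x) (bg9Y (Matrix (Fin N) (Fin N) ℂ) (specialUnitaryUnits (Fin N)) x) (XBK (TrIdx N) x.toKIdx) Y (XHK (TrIdx N) x.toKIdx) W}
    {H : Prop} {B₀ δ₀ σ c δ₃ δQ B₃ c35 α₀ : ℝ}
    {U : (bg9Y (Matrix (Fin N) (Fin N) ℂ) (specialUnitaryUnits (Fin N)) x).Cfg}
    (hU : (bg9Y (Matrix (Fin N) (Fin N) ℂ) (specialUnitaryUnits (Fin N)) x).Reg335 c35 α₀ U)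
    (hrow : RowSum (toB6 (geo9Y x) 1 H) σ c) (hc : 0 ≤ c) (hB₀ : 0 ≤ B₀)
    (hδQ : 0 ≤ δQ) (hδ₃ : 0 ≤ δ₃) (hδ₃0 : δ₃ ≤ δ₀) (hδ₃Q : δ₃ + σ ≤ δQ)
    (hB₃ : B₀ * Real.exp (δQ * ((ℓ : ℝ) + 4)) * c ≤ B₃)
    (hblk : 𝔬.blk = blkBK x.toKIdx bI) (hblkZ : 𝔬.blkZ = blkHK x.toKIdx)
    (hQs : 𝔬.Qstar U = QscoKH x.toKIdx (trBasis N) (bg9Y (Matrix (Fin N) (Fin N) ℂ) (specialUnitaryUnits (Fin N)) x) (fun U => U) (parBY x.toKIdx) U)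
    (he0 : HasMajorant (g := toB6 (geo9Y x) 1 H) 𝔬.blk (𝔬.G0 U)
      (fun (a b : (geo9Y x).Site) => B₀ * (geo9Y x).len a ^ 2 * Real.exp (-(δ₀ * (geo9Y x).dist a b))))
    (hpl : ∀ y : (geo9Y x).Site, 0 ≤ ((((ℓ + 1 : ℕ) : ℝ) ^ (d + 1)) ^ lvl x.hN x.D x.hk y)⁻¹) :
    HasMaj (weightNorm (BlockNorm.ofBlocks (toB6 (geo9Y x) 1 H) 𝔬.blkZ) (fun y => ((((ℓ + 1 : ℕ) : ℝ) ^ (d + 1)) ^ lvl x.hN x.D x.hk y)⁻¹) hpl)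
      (cNorm 1 H 𝔬.blk (fun y => (geo9Y_len_pos x y).le) 2) (𝔬.G0 U ∘ₗ 𝔬.Qstar U)
      (fun a b => B₃ * Real.exp (-(δ₃ * (geo9Y x).dist a b))) := by
  letI : Fintype (geo9K x.toKIdx).Site := (inferInstance : Fintype (geo9Y x).Site)
  have hG : GeoOK (geo9Y x) := ⟨geo9Y_dist_triangle x, geo9Y_dist_comm x, geo9K_dist_nonneg x.toKIdx, geo9Y_len_pos x⟩
  have hqs := hasMaj_Qstar_pins (R₀ := (1 : ℝ)) (H₀ := H) x hβ1 hU hδQ (fun y => (geo9Y_len_pos x y).le) hpl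
  rw [← hblkZ, ← hblk, ← hQs] at hqs
  exact gQs2_of_e0 hG hrow hB₀ (Real.exp_nonneg _) hc hδ₃ hδ₃0 hδ₃Q hB₃ he0 hqs

/-- ★★ **`G₀Q*` OUT OF `Z_{len·n⁻¹}` INTO `𝔠⁽¹⁾` AT THE PINS (ONE p.-398 TRANSFER)** — the field `Letters313Z.gQs1` = `Letters313Zc.gQs1`, every
member, every `Reg335` `U`: from `he0` (HYPOTHESIS), the member facts `hF : Facts347 … dF δF α L₀` ([4] (2.60) at exponent `α`, `L ≤ L₀`),
`hasMaj_Qstar_pins` and dag-n06-l's `gQs1_of_e0`; any `B₃ ≥ B₀·e^{δ_Q(ℓ+4)}·c·L₀`, rates `0 ≤ δ₁ ≤ δ₀`, `δ₁ + σ ≤ δ_Q`, `δ₃ ≤ δ₁ − α·δF`.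
[cite: Balaban1985BackgroundPropagators, (3.153) p.426 + (3.42) p.397 + p.398 (remark after (3.47)) + (3.110) p.417; Balaban1984PropagatorsII, (2.52)–(2.56) pp.232–233 + Lemma 2.1 (2.60)–(2.61) p.234] -/
theorem gQs1_pins (x : MemberY d ℓ hd hL b₀ b₁ Mstar) {bI : FBondY x.toKIdx → IBondY x.toKIdx}
    (hβ1 : ∀ f : FBondY x.toKIdx, (geomT x.D).dist (β x.hN x.D x.hk (bI f)) (blkV1 x.hN x.D f) ≤ 1)
    {Y W : Type} [Fintype Y] [Fintype W]
    {𝔬 : Ops (geo9Y x) (bg9Y (Matrix (Fin N) (Fin N) ℂ) (specialUnitaryUnits (Fin N)) x) (XBK (TrIdx N) x.toKIdx) Y (XHK (TrIdx N) x.toKIdx) W}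
    {H : Prop} {dF : ℕ} {δF α L₀ : ℝ} (hF : Facts347 (geo9Y x) 1 H dF δF α L₀)
    {B₀ δ₀ σ c δ₁ δ₃ δQ B₃ c35 α₀ : ℝ}
    {U : (bg9Y (Matrix (Fin N) (Fin N) ℂ) (specialUnitaryUnits (Fin N)) x).Cfg}
    (hU : (bg9Y (Matrix (Fin N) (Fin N) ℂ) (specialUnitaryUnits (Fin N)) x).Reg335 c35 α₀ U)
    (hrow : RowSum (toB6 (geo9Y x) 1 H) σ c) (hc : 0 ≤ c) (hB₀ : 0 ≤ B₀)
    (hδQ : 0 ≤ δQ) (hδ₁ : 0 ≤ δ₁) (hδ₁0 : δ₁ ≤ δ₀) (hδ₁Q : δ₁ + σ ≤ δQ) (hδ₃ : δ₃ ≤ δ₁ - α * δF)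
    (hB₃ : B₀ * Real.exp (δQ * ((ℓ : ℝ) + 4)) * c * L₀ ≤ B₃)
    (hblk : 𝔬.blk = blkBK x.toKIdx bI) (hblkZ : 𝔬.blkZ = blkHK x.toKIdx)
    (hQs : 𝔬.Qstar U = QscoKH x.toKIdx (trBasis N) (bg9Y (Matrix (Fin N) (Fin N) ℂ) (specialUnitaryUnits (Fin N)) x) (fun U => U) (parBY x.toKIdx) U)
    (he0 : HasMajorant (g := toB6 (geo9Y x) 1 H) 𝔬.blk (𝔬.G0 U)
      (fun (a b : (geo9Y x).Site) => B₀ * (geo9Y x).len a ^ 2 * Real.exp (-(δ₀ * (geo9Y x).dist a b))))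
    (hpl : ∀ y : (geo9Y x).Site, 0 ≤ ((((ℓ + 1 : ℕ) : ℝ) ^ (d + 1)) ^ lvl x.hN x.D x.hk y)⁻¹)
    (hpl' : ∀ y : (geo9Y x).Site, 0 ≤ (geo9Y x).len y * ((((ℓ + 1 : ℕ) : ℝ) ^ (d + 1)) ^ lvl x.hN x.D x.hk y)⁻¹) :
    HasMaj (weightNorm (BlockNorm.ofBlocks (toB6 (geo9Y x) 1 H) 𝔬.blkZ)
        (fun y => (geo9Y x).len y * ((((ℓ + 1 : ℕ) : ℝ) ^ (d + 1)) ^ lvl x.hN x.D x.hk y)⁻¹) hpl')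
      (cNorm 1 H 𝔬.blk (fun y => (geo9Y_len_pos x y).le) 1) (𝔬.G0 U ∘ₗ 𝔬.Qstar U)
      (fun a b => B₃ * Real.exp (-(δ₃ * (geo9Y x).dist a b))) := by
  letI : Fintype (geo9K x.toKIdx).Site := (inferInstance : Fintype (geo9Y x).Site)
  have hG : GeoOK (geo9Y x) := ⟨geo9Y_dist_triangle x, geo9Y_dist_comm x, geo9K_dist_nonneg x.toKIdx, geo9Y_len_pos x⟩
  have hqs := hasMaj_Qstar_pins (R₀ := (1 : ℝ)) (H₀ := H) x hβ1 hU hδQ (fun y => (geo9Y_len_pos x y).le) hpl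
  rw [← hblkZ, ← hblk, ← hQs] at hqs
  exact gQs1_of_e0 hG hF hrow hpl hpl' hB₀ (Real.exp_nonneg _) hc hδ₁ hδ₁0 hδ₁Q hB₃ hδ₃ he0 hqs

/-! ## §2 First order: `∇_UG₀Q*` and `∇_{U,ν}G₀Q*` -/

/-- ★★ **`∇_UG₀Q*` OUT OF `Z_{n⁻¹}` INTO `𝔠_Y⁽¹⁾` AT THE PINS** — the field `LettersHZ.dgQs` = `Letters313DZ.dgQs`, every member, every `Reg335` `U`:
from the (3.42)₁ letter of `∇_UG₀` (`he1`, the G₀ layer's `LeftStep.e1` — HYPOTHESIS), `hasMaj_Qstar_pins` and dag-n06-l's `dgQs_of_e1`; any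
`B₃ ≥ B₀·e^{δ_Q(ℓ+4)}·c`, rates `0 ≤ δ₃ ≤ δ₀`, `δ₃ + σ ≤ δ_Q`.
[cite: Balaban1985BackgroundPropagators, (3.126) p.420 + (3.153) p.426 + (3.42) p.397 + (3.110) p.417; Balaban1984PropagatorsII, (2.52)–(2.56) pp.232–233 + Lemma 2.1 (2.61) p.234] -/
theorem dgQs_pins (x : MemberY d ℓ hd hL b₀ b₁ Mstar) {bI : FBondY x.toKIdx → IBondY x.toKIdx}
    (hβ1 : ∀ f : FBondY x.toKIdx, (geomT x.D).dist (β x.hN x.D x.hk (bI f)) (blkV1 x.hN x.D f) ≤ 1)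
    {Y W : Type} [Fintype Y] [Fintype W]
    {𝔬 : Ops (geo9Y x) (bg9Y (Matrix (Fin N) (Fin N) ℂ) (specialUnitaryUnits (Fin N)) x) (XBK (TrIdx N) x.toKIdx) Y (XHK (TrIdx N) x.toKIdx) W}
    {H : Prop} {B₀ δ₀ σ c δ₃ δQ B₃ c35 α₀ : ℝ}
    {U : (bg9Y (Matrix (Fin N) (Fin N) ℂ) (specialUnitaryUnits (Fin N)) x).Cfg}
    (hU : (bg9Y (Matrix (Fin N) (Fin N) ℂ) (specialUnitaryUnits (Fin N)) x).Reg335 c35 α₀ U)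
    (hrow : RowSum (toB6 (geo9Y x) 1 H) σ c) (hc : 0 ≤ c) (hB₀ : 0 ≤ B₀)
    (hδQ : 0 ≤ δQ) (hδ₃ : 0 ≤ δ₃) (hδ₃0 : δ₃ ≤ δ₀) (hδ₃Q : δ₃ + σ ≤ δQ)
    (hB₃ : B₀ * Real.exp (δQ * ((ℓ : ℝ) + 4)) * c ≤ B₃)
    (hblk : 𝔬.blk = blkBK x.toKIdx bI) (hblkZ : 𝔬.blkZ = blkHK x.toKIdx)
    (hQs : 𝔬.Qstar U = QscoKH x.toKIdx (trBasis N) (bg9Y (Matrix (Fin N) (Fin N) ℂ) (specialUnitaryUnits (Fin N)) x) (fun U => U) (parBY x.toKIdx) U)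
    (he1 : HasMajorantHom (g := toB6 (geo9Y x) 1 H) 𝔬.blk 𝔬.blkY (𝔬.D U ∘ₗ 𝔬.G0 U)
      (fun (a b : (geo9Y x).Site) => B₀ * (geo9Y x).len a * Real.exp (-(δ₀ * (geo9Y x).dist a b))))
    (hpl : ∀ y : (geo9Y x).Site, 0 ≤ ((((ℓ + 1 : ℕ) : ℝ) ^ (d + 1)) ^ lvl x.hN x.D x.hk y)⁻¹) :
    HasMaj (weightNorm (BlockNorm.ofBlocks (toB6 (geo9Y x) 1 H) 𝔬.blkZ) (fun y => ((((ℓ + 1 : ℕ) : ℝ) ^ (d + 1)) ^ lvl x.hN x.D x.hk y)⁻¹) hpl)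
      (cNorm 1 H 𝔬.blkY (fun y => (geo9Y_len_pos x y).le) 1) (𝔬.D U ∘ₗ 𝔬.G0 U ∘ₗ 𝔬.Qstar U)
      (fun a b => B₃ * Real.exp (-(δ₃ * (geo9Y x).dist a b))) := by
  letI : Fintype (geo9K x.toKIdx).Site := (inferInstance : Fintype (geo9Y x).Site)
  have hG : GeoOK (geo9Y x) := ⟨geo9Y_dist_triangle x, geo9Y_dist_comm x, geo9K_dist_nonneg x.toKIdx, geo9Y_len_pos x⟩
  have hqs := hasMaj_Qstar_pins (R₀ := (1 : ℝ)) (H₀ := H) x hβ1 hU hδQ (fun y => (geo9Y_len_pos x y).le) hpl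
  rw [← hblkZ, ← hblk, ← hQs] at hqs
  exact dgQs_of_e1 hG hrow hB₀ (Real.exp_nonneg _) hc hδ₃ hδ₃0 hδ₃Q hB₃ he1 hqs

/-- ★★ **`∇_{U,ν}G₀Q*` OUT OF `Z_{n⁻¹}` INTO `𝔠⁽¹⁾` AT THE PINS, EVERY DIRECTION `ν`** — the field `Letters313DMZ.dgQsd ν`, every member, every
`Reg335` `U`: from the direction letters of `∇_{U,ν}G₀` (`he1d`, the G₀ layer's `Thm33G0Dir.e1d` — HYPOTHESIS), `hasMaj_Qstar_pins` and dag-n06-l's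
`dgQs_of_e1` at `E := ∇_{U,ν}`; any `B₃ ≥ B₀·e^{δ_Q(ℓ+4)}·c`, rates `0 ≤ δ₃ ≤ δ₀`, `δ₃ + σ ≤ δ_Q`.
[cite: Balaban1985BackgroundPropagators, (3.153) p.426 + (3.42) p.397 + (3.110) p.417 + Thm 3.13 p.426; Balaban1984PropagatorsII, (2.52)–(2.56) pp.232–233 + Lemma 2.1 (2.61) p.234] -/
theorem dgQsd_pins (x : MemberY d ℓ hd hL b₀ b₁ Mstar) {bI : FBondY x.toKIdx → IBondY x.toKIdx}
    (hβ1 : ∀ f : FBondY x.toKIdx, (geomT x.D).dist (β x.hN x.D x.hk (bI f)) (blkV1 x.hN x.D f) ≤ 1)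
    {Y W P : Type} [Fintype Y] [Fintype W]
    {𝔬 : Ops (geo9Y x) (bg9Y (Matrix (Fin N) (Fin N) ℂ) (specialUnitaryUnits (Fin N)) x) (XBK (TrIdx N) x.toKIdx) Y (XHK (TrIdx N) x.toKIdx) W}
    {Dd : (bg9Y (Matrix (Fin N) (Fin N) ℂ) (specialUnitaryUnits (Fin N)) x).Cfg → P → Module.End ℝ (XBK (TrIdx N) x.toKIdx → ℝ)}
    {H : Prop} {B₀ δ₀ σ c δ₃ δQ B₃ c35 α₀ : ℝ}
    {U : (bg9Y (Matrix (Fin N) (Fin N) ℂ) (specialUnitaryUnits (Fin N)) x).Cfg}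
    (hU : (bg9Y (Matrix (Fin N) (Fin N) ℂ) (specialUnitaryUnits (Fin N)) x).Reg335 c35 α₀ U)
    (hrow : RowSum (toB6 (geo9Y x) 1 H) σ c) (hc : 0 ≤ c) (hB₀ : 0 ≤ B₀)
    (hδQ : 0 ≤ δQ) (hδ₃ : 0 ≤ δ₃) (hδ₃0 : δ₃ ≤ δ₀) (hδ₃Q : δ₃ + σ ≤ δQ)
    (hB₃ : B₀ * Real.exp (δQ * ((ℓ : ℝ) + 4)) * c ≤ B₃)
    (hblk : 𝔬.blk = blkBK x.toKIdx bI) (hblkZ : 𝔬.blkZ = blkHK x.toKIdx)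
    (hQs : 𝔬.Qstar U = QscoKH x.toKIdx (trBasis N) (bg9Y (Matrix (Fin N) (Fin N) ℂ) (specialUnitaryUnits (Fin N)) x) (fun U => U) (parBY x.toKIdx) U)
    (he1d : ∀ ν : P, HasMajorantHom (g := toB6 (geo9Y x) 1 H) 𝔬.blk 𝔬.blk (Dd U ν ∘ₗ 𝔬.G0 U)
      (fun (a b : (geo9Y x).Site) => B₀ * (geo9Y x).len a * Real.exp (-(δ₀ * (geo9Y x).dist a b))))
    (hpl : ∀ y : (geo9Y x).Site, 0 ≤ ((((ℓ + 1 : ℕ) : ℝ) ^ (d + 1)) ^ lvl x.hN x.D x.hk y)⁻¹) :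
    ∀ ν : P, HasMaj (weightNorm (BlockNorm.ofBlocks (toB6 (geo9Y x) 1 H) 𝔬.blkZ) (fun y => ((((ℓ + 1 : ℕ) : ℝ) ^ (d + 1)) ^ lvl x.hN x.D x.hk y)⁻¹) hpl)
      (cNorm 1 H 𝔬.blk (fun y => (geo9Y_len_pos x y).le) 1) (Dd U ν ∘ₗ 𝔬.G0 U ∘ₗ 𝔬.Qstar U)
      (fun a b => B₃ * Real.exp (-(δ₃ * (geo9Y x).dist a b))) := by
  letI : Fintype (geo9K x.toKIdx).Site := (inferInstance : Fintype (geo9Y x).Site)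
  have hG : GeoOK (geo9Y x) := ⟨geo9Y_dist_triangle x, geo9Y_dist_comm x, geo9K_dist_nonneg x.toKIdx, geo9Y_len_pos x⟩
  have hqs := hasMaj_Qstar_pins (R₀ := (1 : ℝ)) (H₀ := H) x hβ1 hU hδQ (fun y => (geo9Y_len_pos x y).le) hpl
  rw [← hblkZ, ← hblk, ← hQs] at hqs
  intro ν
  exact dgQs_of_e1 hG hrow hB₀ (Real.exp_nonneg _) hc hδ₃ hδ₃0 hδ₃Q hB₃ (he1d ν) hqs

/-! ## §3 Hölder probes: `Φ^X_β∘∇_{U,ν}G₀Q*` and `Φ^X_β∘G₀Q*` -/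

/-- ★★ **`Φ^X_β∘∇_{U,ν}G₀Q*` OUT OF `Z_{n⁻¹}` INTO THE PROBE CLASS `𝔠_P^{(β−1)}` AT THE PINS, EVERY `ν`, EVERY `0 ≤ β < 1`** — the field
`Letters313DMZ.pQd ν β`, every member, every `Reg335` `U`: from the (3.43)-shape probe letters of `Φ^X_β∘∇_{U,ν}G₀` (`h43d`, the G₀ layer's
`Thm33G0Dir.h43d` — HYPOTHESIS), `hasMaj_Qstar_pins` and dag-n06-l's `pQ_of_h43`; any `Bq β ≥ Bh β·e^{δ_Q(ℓ+4)}·c` (the letter of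
`B9LettersHHZWholeAtPins.lettersHHZ_pins`), rates `0 ≤ δ₃ ≤ δ₀`, `δ₃ + σ ≤ δ_Q`.
[cite: Balaban1985BackgroundPropagators, (3.153) p.426 + (3.43) p.398 + (3.110) p.417 + Thm 3.13 p.426; Balaban1984PropagatorsII, (2.52)–(2.56) pp.232–233 + Lemma 2.1 (2.61) p.234] -/
theorem pQd_pins (x : MemberY d ℓ hd hL b₀ b₁ Mstar) {bI : FBondY x.toKIdx → IBondY x.toKIdx}
    (hβ1 : ∀ f : FBondY x.toKIdx, (geomT x.D).dist (β x.hN x.D x.hk (bI f)) (blkV1 x.hN x.D f) ≤ 1)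
    {Y W PX PY P : Type} [Fintype Y] [Fintype W] [Fintype PX] [Fintype PY]
    {𝔬 : Ops (geo9Y x) (bg9Y (Matrix (Fin N) (Fin N) ℂ) (specialUnitaryUnits (Fin N)) x) (XBK (TrIdx N) x.toKIdx) Y (XHK (TrIdx N) x.toKIdx) W}
    {𝔭 : HolderProbes (geo9Y x) (bg9Y (Matrix (Fin N) (Fin N) ℂ) (specialUnitaryUnits (Fin N)) x) (XBK (TrIdx N) x.toKIdx) Y PX PY}
    {Dd : (bg9Y (Matrix (Fin N) (Fin N) ℂ) (specialUnitaryUnits (Fin N)) x).Cfg → P → Module.End ℝ (XBK (TrIdx N) x.toKIdx → ℝ)}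
    {H : Prop} {Bh Bq : ℝ → ℝ} {δ₀ σ c δ₃ δQ c35 α₀ : ℝ}
    {U : (bg9Y (Matrix (Fin N) (Fin N) ℂ) (specialUnitaryUnits (Fin N)) x).Cfg}
    (hU : (bg9Y (Matrix (Fin N) (Fin N) ℂ) (specialUnitaryUnits (Fin N)) x).Reg335 c35 α₀ U)
    (hrow : RowSum (toB6 (geo9Y x) 1 H) σ c) (hc : 0 ≤ c) (hBh : ∀ β, 0 ≤ β → β < 1 → 0 ≤ Bh β)
    (hδQ : 0 ≤ δQ) (hδ₃ : 0 ≤ δ₃) (hδ₃0 : δ₃ ≤ δ₀) (hδ₃Q : δ₃ + σ ≤ δQ)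
    (hBq : ∀ β, 0 ≤ β → β < 1 → Bh β * Real.exp (δQ * ((ℓ : ℝ) + 4)) * c ≤ Bq β)
    (hblk : 𝔬.blk = blkBK x.toKIdx bI) (hblkZ : 𝔬.blkZ = blkHK x.toKIdx)
    (hQs : 𝔬.Qstar U = QscoKH x.toKIdx (trBasis N) (bg9Y (Matrix (Fin N) (Fin N) ℂ) (specialUnitaryUnits (Fin N)) x) (fun U => U) (parBY x.toKIdx) U)
    (h43d : ∀ (ν : P) (β : ℝ), 0 ≤ β → β < 1 →
      HasMajorantHom (g := toB6 (geo9Y x) 1 H) 𝔬.blk 𝔭.blkPX (𝔭.ΦX U β ∘ₗ (Dd U ν ∘ₗ 𝔬.G0 U))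
        (fun (a b : (geo9Y x).Site) => Bh β * (geo9Y x).len a ^ (1 - β) * Real.exp (-(δ₀ * (geo9Y x).dist a b))))
    (hpl : ∀ y : (geo9Y x).Site, 0 ≤ ((((ℓ + 1 : ℕ) : ℝ) ^ (d + 1)) ^ lvl x.hN x.D x.hk y)⁻¹) :
    ∀ (ν : P) (β : ℝ), 0 ≤ β → β < 1 →
      HasMaj (weightNorm (BlockNorm.ofBlocks (toB6 (geo9Y x) 1 H) 𝔬.blkZ) (fun y => ((((ℓ + 1 : ℕ) : ℝ) ^ (d + 1)) ^ lvl x.hN x.D x.hk y)⁻¹) hpl)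
        (cNormR 1 H 𝔭.blkPX (fun y => (geo9Y_len_pos x y).le) (β - 1)) ((𝔭.ΦX U β ∘ₗ Dd U ν ∘ₗ 𝔬.G0 U) ∘ₗ 𝔬.Qstar U)
        (fun a b => Bq β * Real.exp (-(δ₃ * (geo9Y x).dist a b))) := by
  letI : Fintype (geo9K x.toKIdx).Site := (inferInstance : Fintype (geo9Y x).Site)
  have hG : GeoOK (geo9Y x) := ⟨geo9Y_dist_triangle x, geo9Y_dist_comm x, geo9K_dist_nonneg x.toKIdx, geo9Y_len_pos x⟩
  have hqs := hasMaj_Qstar_pins (R₀ := (1 : ℝ)) (H₀ := H) x hβ1 hU hδQ (fun y => (geo9Y_len_pos x y).le) hpl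
  rw [← hblkZ, ← hblk, ← hQs] at hqs
  intro ν β' hβ' hβ'1
  exact pQ_of_h43 hG hrow (hBh β' hβ' hβ'1) (Real.exp_nonneg _) hc hδ₃ hδ₃0 hδ₃Q (hBq β' hβ' hβ'1) (h43d ν β' hβ' hβ'1) hqs

/-- ★★ **`Φ^X_β∘G₀Q*` OUT OF `Z_{len·n⁻¹}` INTO `𝔠_P^{(β−1)}` AT THE PINS, EVERY `0 ≤ β < 1` (ONE p.-398 TRANSFER)** — the field
`Letters313HZ.pXQs β` = `Letters313HZc.pXQs β`, every member, every `Reg335` `U`: from the zeroth-order probe face of `Φ^X_β∘G₀`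
(`hpX0`, the certificate's derived `pX0` face `N06ProbeZeroAtPinsPhys.hX0_of_pins` ∕ the schema `Thm33G0DirX.pX0` — HYPOTHESIS here), the member
facts `hF : Facts347 … dF δF α L₀`, `hasMaj_Qstar_pins` and dag-n06-l's `pXQs_of_pX0`; any `Bx β ≥ Bx0 β·e^{δ_Q(ℓ+4)}·c·L₀`, rates `0 ≤ δ₁ ≤ δ₀`,
`δ₁ + σ ≤ δ_Q`, `δ₃ ≤ δ₁ − α·δF`.
[cite: Balaban1985BackgroundPropagators, (3.153) p.426 + (3.43) p.398 + p.398 (remark after (3.47)) + (3.110) p.417; Balaban1984PropagatorsII, (2.52)–(2.56) pp.232–233 + Lemma 2.1 (2.60)–(2.61) p.234] -/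
theorem pXQs_pins (x : MemberY d ℓ hd hL b₀ b₁ Mstar) {bI : FBondY x.toKIdx → IBondY x.toKIdx}
    (hβ1 : ∀ f : FBondY x.toKIdx, (geomT x.D).dist (β x.hN x.D x.hk (bI f)) (blkV1 x.hN x.D f) ≤ 1)
    {Y W PX PY : Type} [Fintype Y] [Fintype W] [Fintype PX] [Fintype PY]
    {𝔬 : Ops (geo9Y x) (bg9Y (Matrix (Fin N) (Fin N) ℂ) (specialUnitaryUnits (Fin N)) x) (XBK (TrIdx N) x.toKIdx) Y (XHK (TrIdx N) x.toKIdx) W}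
    {𝔭 : HolderProbes (geo9Y x) (bg9Y (Matrix (Fin N) (Fin N) ℂ) (specialUnitaryUnits (Fin N)) x) (XBK (TrIdx N) x.toKIdx) Y PX PY}
    {H : Prop} {dF : ℕ} {δF α L₀ : ℝ} (hF : Facts347 (geo9Y x) 1 H dF δF α L₀)
    {Bx0 Bx : ℝ → ℝ} {δ₀ σ c δ₁ δ₃ δQ c35 α₀ : ℝ}
    {U : (bg9Y (Matrix (Fin N) (Fin N) ℂ) (specialUnitaryUnits (Fin N)) x).Cfg}
    (hU : (bg9Y (Matrix (Fin N) (Fin N) ℂ) (specialUnitaryUnits (Fin N)) x).Reg335 c35 α₀ U)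
    (hrow : RowSum (toB6 (geo9Y x) 1 H) σ c) (hc : 0 ≤ c) (hBx0 : ∀ β, 0 ≤ β → β < 1 → 0 ≤ Bx0 β)
    (hδQ : 0 ≤ δQ) (hδ₁ : 0 ≤ δ₁) (hδ₁0 : δ₁ ≤ δ₀) (hδ₁Q : δ₁ + σ ≤ δQ) (hδ₃ : δ₃ ≤ δ₁ - α * δF)
    (hBx : ∀ β, 0 ≤ β → β < 1 → Bx0 β * Real.exp (δQ * ((ℓ : ℝ) + 4)) * c * L₀ ≤ Bx β)
    (hblk : 𝔬.blk = blkBK x.toKIdx bI) (hblkZ : 𝔬.blkZ = blkHK x.toKIdx)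
    (hQs : 𝔬.Qstar U = QscoKH x.toKIdx (trBasis N) (bg9Y (Matrix (Fin N) (Fin N) ℂ) (specialUnitaryUnits (Fin N)) x) (fun U => U) (parBY x.toKIdx) U)
    (hpX0 : ∀ β : ℝ, 0 ≤ β → β < 1 →
      HasMaj (cNormR 1 H 𝔬.blk (fun y => (geo9Y_len_pos x y).le) 0) (cNormR 1 H 𝔭.blkPX (fun y => (geo9Y_len_pos x y).le) (β - 2))
        (𝔭.ΦX U β ∘ₗ 𝔬.G0 U) (fun a b => Bx0 β * Real.exp (-(δ₀ * (geo9Y x).dist a b))))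
    (hpl : ∀ y : (geo9Y x).Site, 0 ≤ ((((ℓ + 1 : ℕ) : ℝ) ^ (d + 1)) ^ lvl x.hN x.D x.hk y)⁻¹)
    (hpl' : ∀ y : (geo9Y x).Site, 0 ≤ (geo9Y x).len y * ((((ℓ + 1 : ℕ) : ℝ) ^ (d + 1)) ^ lvl x.hN x.D x.hk y)⁻¹) :
    ∀ β : ℝ, 0 ≤ β → β < 1 →
      HasMaj (weightNorm (BlockNorm.ofBlocks (toB6 (geo9Y x) 1 H) 𝔬.blkZ)
          (fun y => (geo9Y x).len y * ((((ℓ + 1 : ℕ) : ℝ) ^ (d + 1)) ^ lvl x.hN x.D x.hk y)⁻¹) hpl')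
        (cNormR 1 H 𝔭.blkPX (fun y => (geo9Y_len_pos x y).le) (β - 1)) ((𝔭.ΦX U β ∘ₗ 𝔬.G0 U) ∘ₗ 𝔬.Qstar U)
        (fun a b => Bx β * Real.exp (-(δ₃ * (geo9Y x).dist a b))) := by
  letI : Fintype (geo9K x.toKIdx).Site := (inferInstance : Fintype (geo9Y x).Site)
  have hG : GeoOK (geo9Y x) := ⟨geo9Y_dist_triangle x, geo9Y_dist_comm x, geo9K_dist_nonneg x.toKIdx, geo9Y_len_pos x⟩
  have hqs := hasMaj_Qstar_pins (R₀ := (1 : ℝ)) (H₀ := H) x hβ1 hU hδQ (fun y => (geo9Y_len_pos x y).le) hpl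
  rw [← hblkZ, ← hblk, ← hQs] at hqs
  intro β' hβ' hβ'1
  exact pXQs_of_pX0 hG hF hrow hpl hpl' (hBx0 β' hβ' hβ'1) (Real.exp_nonneg _) hc hδ₁ hδ₁0 hδ₁Q (hBx β' hβ' hβ'1) hδ₃
    (hpX0 β' hβ' hβ'1) hqs

/-! ## §4 The averaging operator `Q` between the sharp classes -/

/-- ★ **`Q(U)` OUT OF `𝔠⁽ᵖ⁾` INTO THE SHARP AVERAGING CLASS `Z⁽ᵖ⁾` AT THE PINS, RE-LETTERED TO THE SCHEMA KERNEL** — the fields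
`Letters313Z.q2 ∕ q1` = `Letters313Zc.q2 ∕ q1` (`p = 2, 1`), every member, every `Reg335` `U`: this base's `B9QLettersAtPins.hasMaj_Q_pins` (kernel
`Lᵖ·e^{2ε(ℓ+4)}·e^{−εd}` above the member threshold `p·log L ≤ ε(2L²−1)M`) read through the pins `hblk`, `hblkZ`, `hQ : 𝔬.Q U = QcoKH … U` and
weakened to `B₃·e^{−δ₃d}` for any `ε > 0` with `δ₃ ≤ ε` and `B₃ ≥ Lᵖ·e^{2ε(ℓ+4)}` (`L = (geo9Y x).L`).
[cite: Balaban1985BackgroundPropagators, (3.110) p.417 + (3.42) p.397 + (3.153) p.426 + Thm 3.13 p.426; Balaban1984PropagatorsI, (1.18) p.20] -/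
theorem q_pins (x : MemberY d ℓ hd hL b₀ b₁ Mstar) {bI : FBondY x.toKIdx → IBondY x.toKIdx}
    (hβ1 : ∀ f : FBondY x.toKIdx, (geomT x.D).dist (β x.hN x.D x.hk (bI f)) (blkV1 x.hN x.D f) ≤ 1)
    {Y W : Type} [Fintype Y] [Fintype W]
    {𝔬 : Ops (geo9Y x) (bg9Y (Matrix (Fin N) (Fin N) ℂ) (specialUnitaryUnits (Fin N)) x) (XBK (TrIdx N) x.toKIdx) Y (XHK (TrIdx N) x.toKIdx) W}
    {H : Prop} {ε δ₃ B₃ c35 α₀ : ℝ}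
    {U : (bg9Y (Matrix (Fin N) (Fin N) ℂ) (specialUnitaryUnits (Fin N)) x).Cfg}
    (hU : (bg9Y (Matrix (Fin N) (Fin N) ℂ) (specialUnitaryUnits (Fin N)) x).Reg335 c35 α₀ U)
    (p : ℕ) (hε : 0 < ε) (hδ₃ε : δ₃ ≤ ε)
    (hM : (p : ℝ) * Real.log (geo9Y x).L ≤ ε * (2 * ((ℓ : ℝ) + 1) ^ 2 - 1) * (geo9Y x).M)
    (hB₃ : (geo9Y x).L ^ p * Real.exp (2 * ε * ((ℓ : ℝ) + 4)) ≤ B₃)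
    (hblk : 𝔬.blk = blkBK x.toKIdx bI) (hblkZ : 𝔬.blkZ = blkHK x.toKIdx)
    (hQ : 𝔬.Q U = QcoKH x.toKIdx (trBasis N) (bg9Y (Matrix (Fin N) (Fin N) ℂ) (specialUnitaryUnits (Fin N)) x) (fun U => U) (parBY x.toKIdx) U) :
    HasMaj (cNorm 1 H 𝔬.blk (fun y => (geo9Y_len_pos x y).le) p) (cNorm 1 H 𝔬.blkZ (fun y => (geo9Y_len_pos x y).le) p) (𝔬.Q U)
      (fun a b => B₃ * Real.exp (-(δ₃ * (geo9Y x).dist a b))) := by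
  letI : Fintype (geo9K x.toKIdx).Site := (inferInstance : Fintype (geo9Y x).Site)
  have hG : GeoOK (geo9Y x) := ⟨geo9Y_dist_triangle x, geo9Y_dist_comm x, geo9K_dist_nonneg x.toKIdx, geo9Y_len_pos x⟩
  have hq := hasMaj_Q_pins (R₀ := (1 : ℝ)) (H₀ := H) x hG hβ1 hU hε p hM
  rw [← hblkZ, ← hblk, ← hQ] at hq
  refine hq.mono fun a b => ?_
  have hd0 : 0 ≤ (geo9Y x).dist a b := geo9K_dist_nonneg x.toKIdx a b
  have h1 : Real.exp (-(ε * (geo9Y x).dist a b)) ≤ Real.exp (-(δ₃ * (geo9Y x).dist a b)) :=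
    Real.exp_le_exp.mpr (neg_le_neg (mul_le_mul_of_nonneg_right hδ₃ε hd0))
  have h0 : 0 ≤ (geo9Y x).L ^ p * Real.exp (2 * ε * ((ℓ : ℝ) + 4)) :=
    mul_nonneg (pow_nonneg (zero_le_one.trans (geo9K_one_le_L x.toKIdx)) p) (Real.exp_nonneg _)
  calc (geo9Y x).L ^ p * Real.exp (2 * ε * ((ℓ : ℝ) + 4)) * Real.exp (-(ε * (geo9Y x).dist a b))
      ≤ (geo9Y x).L ^ p * Real.exp (2 * ε * ((ℓ : ℝ) + 4)) * Real.exp (-(δ₃ * (geo9Y x).dist a b)) :=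
        mul_le_mul_of_nonneg_left h1 h0
    _ ≤ B₃ * Real.exp (-(δ₃ * (geo9Y x).dist a b)) := mul_le_mul_of_nonneg_right hB₃ (Real.exp_nonneg _)

end Literature.MathematicalPhysics.QuantumFieldTheory.Balaban1983to89.B9LettersZQstarFieldsAtPins

end
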